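import Literature.NumberTheory.Rogawski1990.ArchOrbFamGSmoothModelParam        -- ★ (A4′) p851133 (LH5-p02 (g4)): `contDiffOn_smoothModel_prod_param`, `isOpen_setOf_inRegAt`; brings ★ (A4) `contDiff_coe_gprimeBlock`, `contDiff_coe_torusFamily_comp`, `continuous_of_coe`, `boostEig`
import Literature.NumberTheory.Automorphic.ArchTorusOrbitalFubiniSmooth            -- ★ `isCompact_setOf_coe_archLocal_mem` (matrix-compact ⇒ group-compact in `U(α)_w`)
import Literature.NumberTheory.Automorphic.UnitaryFormGroupTestFunctionExtension    -- ★ `isClosedEmbedding_coe_unitaryGroupOfForm` (`U(J) ↪ M₃(ℂ)` closed)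
import Literature.NumberTheory.Rogawski1990.ArchOrbFamGExtCentralPartialModel   -- ★ (J2-b) p851294 (this seat): `continuous_readBlock` (reused), the one-slot twin
import HarnessLib

/-!
# (M3) — the PARTIAL unfolded model with SEVERAL isolated compact places: jointly `C^∞` in (coordinates, isolated matrix slots), uniform compact slot supports
# (Varadarajan 1977 I §1.12; Rogawski 1990 §8.2–8.3; Hörmander ALPDO I Thm. 1.1.9 — through ★ (A4′))

Topic `NumberTheory/Rogawski1990`; namespaces `Literature.NumberTheory.Rogawski1990` (§1 recombination) and `Literature.NumberTheory.Automorphic.UnitaryGroup` (§2–§3).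
THEOREMS ONLY (no `def`, no instance, no notation, no axiom, no named fact, no `sorry`).  Cell `pub/hodgecm-mathlib`, crux H413 (`stmt-HodgeConjecture-24833`), F0∕P3c line LH3
(closer stub `stub_N9`, leaf v6∕v8), organ **O-L1d′ `stub_N9hcCentralMixedJetBounds`** (mixed scalar corners); brick **(M3)** of LH3-plan (g4) RULING #20 (2026-09-02T12:01:53Z;
binder of record F0P3a-p08 (g23), consumer = his ★ J1-MIXED junction `exists_nhds_bddAbove_norm_iteratedFDeriv_orbFamGExt_of_mixedModel`, p851386); seat A-p12 (g28).  The
predicate twin of ★ (J2-b) `ArchOrbFamGExtCentralPartialModel` (p851294): ONE isolated place `w₀` ↦ a decidable predicate `p` of isolated compact places.  Count-neutral.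

THE MATHEMATICS.  Fix a decidable set `p` of compact places (the nc-singular compact places `T = F ⊔ Z` of a mixed corner; `p w → w ∉ S′`).  The partial unfolded model with
the `p`-slots opened up as free MATRIX variables `X : {w ∣ p w} → M₃(ℂ)` is
`Θ(c, X) = ∫_{((Π_{i∉S′, ¬p i} U_i) ⧸ Π T′_i) × (Π_{j∈S′} K×N)} φ̃( recombine( X_w at p w ∣ (ḡ_i γ_i(c) ḡ_i⁻¹)_i at the other compact places ∣ (T_j⁻¹ · k_j τ(0,φ_j,θ_j) τ(x_j∕2,0,0) n_j τ(x_j∕2,0,0) k_j⁻¹ · T_j)_j at j ∈ S′ ) )`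
(`φ̃ ∈ C_c^∞(M₃(L ⊗ ℝ))` the ambient lift of the test function, ★ `ArchSmooth.exists_contDiff`).  §2 HEAD: `Θ` is `ContDiffOn ℝ ∞` on `{c | in-regular at every compact i, ¬ p i} ×ˢ univ` —
ONE call of ★ (A4′) `contDiffOn_smoothModel_prod_param` with the extra parameter `Z := ({w ∣ p w} → M₃(ℂ))`, `T := univ`, the LINEAR recombination (§1) inside the smooth factorisation,
and the support clause read matrix-side (★ `isCompact_setOf_coe_archLocal_mem`, ★ `isClosedEmbedding_coe_unitaryGroupOfForm`, the `n_j` by the continuous word inversion) — verbatim the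
★ (J2-b) proof.  §3: uniform compact slot supports — for every isolated `w` ONE compact `C_w ⊆ U(α)_w` such that the integrand vanishes whenever the `w`-slot is `↑↑k` with
`k ∉ C_w` (whatever the other slots).  After (M1) (★ finset isolation, F0P3a-p05 (g21)) and (M2) (one-place parametric box descent at the face slots, LH3-p04 (g4)), these are the `hf`
and block-support binders of the mixed junction.
HONEST LABEL: HC_CM is proved only modulo the 7 printed citations (2 remaining: hLiu418 = `stmt-HodgeConjecture-24832`, h413 = `stmt-HodgeConjecture-24833`) until rung 0 closes; this file
moves no row of the books.

## References
* [Varadarajan1977] V. S. Varadarajan, *Harmonic Analysis on Real Reductive Groups*, LNM 576 (1977), Part I §1.12 (descent: the other places as smooth parameters).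
* [Rogawski1990] J. D. Rogawski, *Automorphic Representations of Unitary Groups in Three Variables*, Ann. of Math. Stud. 123 (1990), §4.9 p. 55; §8.2 p. 122; §8.3 p. 124.
* [HormanderALPDO1] L. Hörmander, *The Analysis of Linear Partial Differential Operators I*, Grundlehren 256 (1983), §1.1 Thm. 1.1.9.
* [BorelJacquet1979] A. Borel, H. Jacquet, *Automorphic forms and automorphic representations*, PSPM 33.1 (1979), §4.1 (`G_∞ = Π_v G(F_v)`).
* [DeitmarEchterhoff2014] A. Deitmar, S. Echterhoff, *Principles of Harmonic Analysis*, 2nd ed. (2014), Lemma 9.3.3.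
-/

set_option autoImplicit false

noncomputable section

open MeasureTheory MeasureTheory.Measure Matrix NumberField NumberField.InfinitePlace NumberField.mixedEmbedding Set Function Topology Complex
open Literature.MeasureTheory.Group Literature.NumberTheory.Rogawski1990 Literature.NumberTheory.Automorphic.ArchCartan
open Literature.NumberTheory.Automorphic.UnitaryGroup
open scoped MatrixGroups ContDiff Classical
open scoped Matrix.Norms.Operator

/-! ## §1 The recombination «`p`-slots ∣ the other compact places ∣ split places» is LINEAR in the ambient matrices -/

namespace Literature.NumberTheory.Rogawski1990

section Recombine3

variable (L : Type) [Field L] [NumberField L] (S' : Finset {w : InfinitePlace L // IsComplex w}) (p : {w : InfinitePlace L // IsComplex w} → Prop) [DecidablePred p]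

/-- **The recombination is ℝ-linear, hence `C^∞`**: `(X, m_g, m_u) ↦ Matrix.of (a, b) ↦ (0, w ↦ [w ∈ S′] m_u(w)_{ab} ∣ [p w] X(w)_{ab} ∣ [else] m_g(w)_{ab})` into `M₃(L ⊗ ℝ)`
(predicate twin of ★ `exists_contDiff_recombineMatrix₃`). [cite: BorelJacquet1979, §4.1] -/
theorem exists_contDiff_recombineMatrixPred :
    ∃ Λ : (({w : {w : InfinitePlace L // IsComplex w} // p w} → Matrix (Fin 3) (Fin 3) ℂ) × (({w : {w : InfinitePlace L // IsComplex w} // w ∉ S' ∧ ¬ p w} → Matrix (Fin 3) (Fin 3) ℂ) ×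
        (↥S' → Matrix (Fin 3) (Fin 3) ℂ))) → Matrix (Fin 3) (Fin 3) (mixedSpace L),
      ContDiff ℝ ∞ Λ ∧ ∀ X mg mu, Λ (X, (mg, mu)) = Matrix.of fun a b => ((0 : {w : InfinitePlace L // IsReal w} → ℝ),
        fun w : {w : InfinitePlace L // IsComplex w} =>
          if hw : p w then X ⟨w, hw⟩ a b else if h : w ∈ S' then mu ⟨w, h⟩ a b else mg ⟨w, ⟨h, hw⟩⟩ a b) := by
  classical
  let Λ : (({w : {w : InfinitePlace L // IsComplex w} // p w} → Matrix (Fin 3) (Fin 3) ℂ) × (({w : {w : InfinitePlace L // IsComplex w} // w ∉ S' ∧ ¬ p w} → Matrix (Fin 3) (Fin 3) ℂ) ×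
      (↥S' → Matrix (Fin 3) (Fin 3) ℂ))) →ₗ[ℝ] Matrix (Fin 3) (Fin 3) (mixedSpace L) :=
    { toFun := fun q => Matrix.of fun a b => ((0 : {w : InfinitePlace L // IsReal w} → ℝ),
        fun w : {w : InfinitePlace L // IsComplex w} =>
          if hw : p w then q.1 ⟨w, hw⟩ a b else if h : w ∈ S' then q.2.2 ⟨w, h⟩ a b else q.2.1 ⟨w, ⟨h, hw⟩⟩ a b)
      map_add' := fun q q' => by
        ext a b
        · simp
        · rename_i w
          simp only [Prod.fst_add, Prod.snd_add, Matrix.of_apply, Matrix.add_apply, Pi.add_apply]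
          split_ifs <;> rfl
      map_smul' := fun c q => by
        ext a b
        · simp
        · rename_i w
          simp only [Prod.smul_fst, Prod.smul_snd, Matrix.of_apply, Matrix.smul_apply, RingHom.id_apply, Pi.smul_apply]
          split_ifs <;> rfl }
  exact ⟨Λ, (LinearMap.toContinuousLinearMap Λ).contDiff, fun X mg mu => rfl⟩

end Recombine3

end Literature.NumberTheory.Rogawski1990

/-! ## §2–§3 The partial unfolded model with `p`-slots: joint smoothness through ★ (A4′), uniform compact slot supports -/

namespace Literature.NumberTheory.Automorphic.UnitaryGroup

section PartialModel

variable (L : Type) [Field L] [NumberField L] [IsCMField L] (α : Fin 3 → L) (S' : Finset {w : InfinitePlace L // IsComplex w})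
  (p : {w : InfinitePlace L // IsComplex w} → Prop) [DecidablePred p]

/-- **(M3) HEAD — THE PARTIAL UNFOLDED MODEL WITH `p`-SLOTS IS JOINTLY `C^∞` IN (COORDINATES, ISOLATED MATRIX SLOTS).**  Frame data `hα hreal hS′`; the compact places
outside `S′` and outside the isolated set `p` indexed by the flat subtype `{w ∕∕ w ∉ S′ ∧ ¬ p w}` with a measure `μ` finite on compacta on their chart quotient; the standard split
group `U(J₃)(ℂ)` (`hJ`) with ONE compact subgroup `K`, an s-finite measure `ν` finite on compacta on the split fibre `Π_{S′} (K × N)`, the boost torus family through its matrix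
(`hτcoe`), the split frames as fixed `T_j ∈ GL₃(ℂ)`, an ambient test function `φ̃ ∈ C_c^∞(M₃(L ⊗ ℝ))`.  THEN `(c, X) ↦ ∫ descConj γ(c) (φ̃ ∘ recombine(X ∣ spectators ∣ split words(c)))`
is `ContDiffOn ℝ ∞` on `{c | in-regular at every compact i ∉ S′, ¬ p i} ×ˢ univ` — ★ (A4′) at `Z := ({w ∣ p w} → M₃(ℂ))`, `T := univ` (the ★ (J2-b) proof with a family of slots).
[cite: Varadarajan1977, I §1.12] [cite: Rogawski1990, §4.9 p. 55; §8.2 p. 122; §8.3 p. 124] [cite: HormanderALPDO1, §1.1 Thm. 1.1.9] -/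
theorem contDiffOn_partialUnfoldedModel_pred (hα : ∀ i, α i ≠ 0) (hreal : ∀ (w : {w : InfinitePlace L // IsComplex w}) (i : Fin 3), (w.1.embedding (α i)).im = 0)
    (hS' : ∀ w, w ∈ S' → w ∈ splitChartPlaces L α) (hp : ∀ w, p w → w ∉ S')
    [MeasurableSpace ((∀ i : {w : {w : InfinitePlace L // IsComplex w} // w ∉ S' ∧ ¬ p w}, ↥(archLocal L 3 (Matrix.diagonal α) i.1)) ⧸
      Subgroup.pi Set.univ (fun i : {w : {w : InfinitePlace L // IsComplex w} // w ∉ S' ∧ ¬ p w} => chartTorusGLoc L α i.1 S'))]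
    [BorelSpace ((∀ i : {w : {w : InfinitePlace L // IsComplex w} // w ∉ S' ∧ ¬ p w}, ↥(archLocal L 3 (Matrix.diagonal α) i.1)) ⧸
      Subgroup.pi Set.univ (fun i : {w : {w : InfinitePlace L // IsComplex w} // w ∉ S' ∧ ¬ p w} => chartTorusGLoc L α i.1 S'))]
    (μ : Measure ((∀ i : {w : {w : InfinitePlace L // IsComplex w} // w ∉ S' ∧ ¬ p w}, ↥(archLocal L 3 (Matrix.diagonal α) i.1)) ⧸
      Subgroup.pi Set.univ (fun i : {w : {w : InfinitePlace L // IsComplex w} // w ∉ S' ∧ ¬ p w} => chartTorusGLoc L α i.1 S')))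
    [IsFiniteMeasureOnCompacts μ]
    {J : Matrix (Fin 3) (Fin 3) ℂ} (hJ : J = (StdForm.antidiagonal 3).over ℂ)
    [MeasurableSpace ↥(unitaryGroupOfForm (starRingEnd ℂ) J)] [BorelSpace ↥(unitaryGroupOfForm (starRingEnd ℂ) J)]
    (K : Subgroup ↥(unitaryGroupOfForm (starRingEnd ℂ) J)) (hK : IsCompact (K : Set ↥(unitaryGroupOfForm (starRingEnd ℂ) J)))
    (ν : Measure (↥S' → ↥K × ↥(unipotentU (starRingEnd ℂ) J))) [IsFiniteMeasureOnCompacts ν] [SFinite ν]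
    (τ : (Fin 3 → ℝ) → ↥(unitaryGroupOfForm (starRingEnd ℂ) J))
    (hτcoe : ∀ c, (((τ c : ↥(unitaryGroupOfForm (starRingEnd ℂ) J)) : GL (Fin 3) ℂ) : Matrix (Fin 3) (Fin 3) ℂ) = Matrix.diagonal (boostEig c))
    (T : ↥S' → GL (Fin 3) ℂ)
    (φ : Matrix (Fin 3) (Fin 3) (mixedSpace L) → ℂ) (hφ : ContDiff ℝ ∞ φ) (hφc : HasCompactSupport φ) :
    ContDiffOn ℝ ∞ (fun q : ({w : InfinitePlace L // IsComplex w} → Fin 3 → ℝ) × ({w : {w : InfinitePlace L // IsComplex w} // p w} → Matrix (Fin 3) (Fin 3) ℂ) =>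
        ∫ r : ((∀ i : {w : {w : InfinitePlace L // IsComplex w} // w ∉ S' ∧ ¬ p w}, ↥(archLocal L 3 (Matrix.diagonal α) i.1)) ⧸
              Subgroup.pi Set.univ (fun i : {w : {w : InfinitePlace L // IsComplex w} // w ∉ S' ∧ ¬ p w} => chartTorusGLoc L α i.1 S')) ×
            (↥S' → ↥K × ↥(unipotentU (starRingEnd ℂ) J)),
          descConj (fun i : {w : {w : InfinitePlace L // IsComplex w} // w ∉ S' ∧ ¬ p w} => gprimeBlock L α i.1 S' q.1)
            (Subgroup.pi Set.univ (fun i : {w : {w : InfinitePlace L // IsComplex w} // w ∉ S' ∧ ¬ p w} => chartTorusGLoc L α i.1 S'))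
            (forall_mem_pi_chartTorusGLoc_comm L α S' (fun i : {w : {w : InfinitePlace L // IsComplex w} // w ∉ S' ∧ ¬ p w} => i.1) q.1)
            (fun g => φ (Matrix.of fun a b => ((0 : {w : InfinitePlace L // IsReal w} → ℝ),
              fun w : {w : InfinitePlace L // IsComplex w} =>
                if hw : p w then q.2 ⟨w, hw⟩ a b
                else if h : w ∈ S' then
                  ((((T ⟨w, h⟩)⁻¹ : GL (Fin 3) ℂ) : Matrix (Fin 3) (Fin 3) ℂ) *
                    (((((r.2 ⟨w, h⟩).1 : ↥(unitaryGroupOfForm (starRingEnd ℂ) J)) *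
                        (τ ![0, q.1 w 1, q.1 w 2] * τ ![q.1 w 0 / 2, 0, 0] * ((r.2 ⟨w, h⟩).2 : ↥(unitaryGroupOfForm (starRingEnd ℂ) J)) * τ ![q.1 w 0 / 2, 0, 0]) *
                        ((r.2 ⟨w, h⟩).1 : ↥(unitaryGroupOfForm (starRingEnd ℂ) J))⁻¹ : ↥(unitaryGroupOfForm (starRingEnd ℂ) J)) : GL (Fin 3) ℂ) : Matrix (Fin 3) (Fin 3) ℂ) *
                    ((T ⟨w, h⟩ : GL (Fin 3) ℂ) : Matrix (Fin 3) (Fin 3) ℂ)) a b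
                else ((((g ⟨w, ⟨h, hw⟩⟩ : ↥(archLocal L 3 (Matrix.diagonal α) w)) : GL (Fin 3) ℂ) : Matrix (Fin 3) (Fin 3) ℂ)) a b)))
            r.1 ∂(μ.prod ν))
      ({c : {w : InfinitePlace L // IsComplex w} → Fin 3 → ℝ |
        ∀ (i : {w : {w : InfinitePlace L // IsComplex w} // w ∉ S' ∧ ¬ p w}) (a b : Fin 3), a ≠ b →
          slotSign L α i.1 a ≠ slotSign L α i.1 b → Circle.exp (c i.1 a) ≠ Circle.exp (c i.1 b)} ×ˢ (univ : Set ({w : {w : InfinitePlace L // IsComplex w} // p w} → Matrix (Fin 3) (Fin 3) ℂ))) := by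
  -- frame facts and instances
  have hN : IsClosed (unipotentU (starRingEnd ℂ) J : Set ↥(unitaryGroupOfForm (starRingEnd ℂ) J)) := LineRing.isClosed_unipotentU _ _
  have hJJ : J * J = 1 := by rw [hJ]; exact StdForm.over_mul_over _ _
  have hJdet : J.det ≠ 0 := by
    intro h0
    have h1 := congrArg Matrix.det hJJ
    rw [Matrix.det_mul, h0, zero_mul, Matrix.det_one] at h1
    exact zero_ne_one h1
  haveI : LocallyCompactSpace ↥(unitaryGroupOfForm (starRingEnd ℂ) J) := locallyCompactSpace_unitaryGroupOfForm_complex J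
  haveI : SecondCountableTopology ↥(unitaryGroupOfForm (starRingEnd ℂ) J) := secondCountableTopology_unitaryGroupOfForm_complex J
  haveI : SecondCountableTopology ↥(unipotentU (starRingEnd ℂ) J) := TopologicalSpace.Subtype.secondCountableTopology _
  haveI : SecondCountableTopology ↥K := TopologicalSpace.Subtype.secondCountableTopology _
  haveI : BorelSpace ↥(unipotentU (starRingEnd ℂ) J) := Subtype.borelSpace _
  haveI : BorelSpace ↥K := Subtype.borelSpace _
  haveI : BorelSpace (↥K × ↥(unipotentU (starRingEnd ℂ) J)) := Prod.borelSpace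
  haveI : CompactSpace ↥K := isCompact_iff_compactSpace.1 hK
  -- the 3-slot recombination
  obtain ⟨Λ, hΛ, hΛapply⟩ := exists_contDiff_recombineMatrixPred L S' p
  -- the fibre datum `r(η) = (↑↑k_j, ↑↑n_j, ↑↑k_j⁻¹)_j`
  have hcoe : Continuous fun u : ↥(unitaryGroupOfForm (starRingEnd ℂ) J) => ((u : GL (Fin 3) ℂ) : Matrix (Fin 3) (Fin 3) ℂ) :=
    Units.continuous_val.comp continuous_subtype_val
  let r : (↥S' → ↥K × ↥(unipotentU (starRingEnd ℂ) J)) → (↥S' → Matrix (Fin 3) (Fin 3) ℂ × Matrix (Fin 3) (Fin 3) ℂ × Matrix (Fin 3) (Fin 3) ℂ) :=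
    fun η j => ((((((η j).1 : ↥K) : ↥(unitaryGroupOfForm (starRingEnd ℂ) J)) : GL (Fin 3) ℂ) : Matrix (Fin 3) (Fin 3) ℂ),
      (((((η j).2 : ↥(unipotentU (starRingEnd ℂ) J)) : ↥(unitaryGroupOfForm (starRingEnd ℂ) J)) : GL (Fin 3) ℂ) : Matrix (Fin 3) (Fin 3) ℂ),
      ((((((η j).1 : ↥K) : ↥(unitaryGroupOfForm (starRingEnd ℂ) J))⁻¹ : ↥(unitaryGroupOfForm (starRingEnd ℂ) J)) : GL (Fin 3) ℂ) :
        Matrix (Fin 3) (Fin 3) ℂ))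
  have hr : Continuous r := by
    refine continuous_pi fun j => ?_
    have hη : Continuous fun η : (↥S' → ↥K × ↥(unipotentU (starRingEnd ℂ) J)) => η j := continuous_apply j
    exact (hcoe.comp (continuous_subtype_val.comp (continuous_fst.comp hη))).prodMk
      ((hcoe.comp (continuous_subtype_val.comp (continuous_snd.comp hη))).prodMk
        (hcoe.comp ((continuous_subtype_val.comp (continuous_fst.comp hη)).inv)))
  -- movers: smooth coordinate vectors, continuity in `U(J₃)(ℂ)`
  have hgm : ∀ j : ↥S', ContDiff ℝ ∞ fun c : {w : InfinitePlace L // IsComplex w} → Fin 3 → ℝ => (![0, c j.1 1, c j.1 2] : Fin 3 → ℝ) := fun j => by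
    refine contDiff_pi.2 fun i => ?_
    fin_cases i
    · exact contDiff_const
    · exact contDiff_apply_apply ℝ ℝ j.1 1
    · exact contDiff_apply_apply ℝ ℝ j.1 2
  have hgs : ∀ j : ↥S', ContDiff ℝ ∞ fun c : {w : InfinitePlace L // IsComplex w} → Fin 3 → ℝ => (![c j.1 0 / 2, 0, 0] : Fin 3 → ℝ) := fun j => by
    refine contDiff_pi.2 fun i => ?_
    fin_cases i
    · exact (contDiff_apply_apply ℝ ℝ j.1 0).div_const 2
    · exact contDiff_const
    · exact contDiff_const
  have hct : ∀ g : ({w : InfinitePlace L // IsComplex w} → Fin 3 → ℝ) → (Fin 3 → ℝ), ContDiff ℝ ∞ g →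
      Continuous fun c => τ (g c) := fun g hg =>
    continuous_of_coe Complex.continuous_conj hJJ (contDiff_coe_torusFamily_comp τ hτcoe hg).continuous
  -- the integrand `F` and its smooth factorisation `Θ̃`
  obtain ⟨F, hFdef⟩ : ∃ F : (({w : InfinitePlace L // IsComplex w} → Fin 3 → ℝ) × ({w : {w : InfinitePlace L // IsComplex w} // p w} → Matrix (Fin 3) (Fin 3) ℂ)) →
      (∀ i : {w : {w : InfinitePlace L // IsComplex w} // w ∉ S' ∧ ¬ p w}, ↥(archLocal L 3 (Matrix.diagonal α) i.1)) →
      (↥S' → ↥K × ↥(unipotentU (starRingEnd ℂ) J)) → ℂ,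
      F = fun q g η => φ (Matrix.of fun a b => ((0 : {w : InfinitePlace L // IsReal w} → ℝ),
        fun w : {w : InfinitePlace L // IsComplex w} =>
          if hw : p w then q.2 ⟨w, hw⟩ a b
          else if h : w ∈ S' then
            ((((T ⟨w, h⟩)⁻¹ : GL (Fin 3) ℂ) : Matrix (Fin 3) (Fin 3) ℂ) *
              (((((η ⟨w, h⟩).1 : ↥(unitaryGroupOfForm (starRingEnd ℂ) J)) *
                  (τ ![0, q.1 w 1, q.1 w 2] * τ ![q.1 w 0 / 2, 0, 0] * ((η ⟨w, h⟩).2 : ↥(unitaryGroupOfForm (starRingEnd ℂ) J)) * τ ![q.1 w 0 / 2, 0, 0]) *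
                  ((η ⟨w, h⟩).1 : ↥(unitaryGroupOfForm (starRingEnd ℂ) J))⁻¹ : ↥(unitaryGroupOfForm (starRingEnd ℂ) J)) : GL (Fin 3) ℂ) : Matrix (Fin 3) (Fin 3) ℂ) *
              ((T ⟨w, h⟩ : GL (Fin 3) ℂ) : Matrix (Fin 3) (Fin 3) ℂ)) a b
          else ((((g ⟨w, ⟨h, hw⟩⟩ : ↥(archLocal L 3 (Matrix.diagonal α) w)) : GL (Fin 3) ℂ) : Matrix (Fin 3) (Fin 3) ℂ)) a b)) := ⟨_, rfl⟩
  -- the split word in matrix currency, as a function of (fibre matrices, coordinates)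
  obtain ⟨word, hword⟩ : ∃ word : ↥S' → (Matrix (Fin 3) (Fin 3) ℂ × Matrix (Fin 3) (Fin 3) ℂ × Matrix (Fin 3) (Fin 3) ℂ) →
      ({w : InfinitePlace L // IsComplex w} → Fin 3 → ℝ) → Matrix (Fin 3) (Fin 3) ℂ,
      word = fun j m c => (((T j)⁻¹ : GL (Fin 3) ℂ) : Matrix (Fin 3) (Fin 3) ℂ) *
        (m.1 * ((((τ ![0, c j.1 1, c j.1 2] : ↥(unitaryGroupOfForm (starRingEnd ℂ) J)) : GL (Fin 3) ℂ) : Matrix (Fin 3) (Fin 3) ℂ) *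
          (((τ ![c j.1 0 / 2, 0, 0] : ↥(unitaryGroupOfForm (starRingEnd ℂ) J)) : GL (Fin 3) ℂ) : Matrix (Fin 3) (Fin 3) ℂ) * m.2.1 *
          (((τ ![c j.1 0 / 2, 0, 0] : ↥(unitaryGroupOfForm (starRingEnd ℂ) J)) : GL (Fin 3) ℂ) : Matrix (Fin 3) (Fin 3) ℂ)) * m.2.2) *
        ((T j : GL (Fin 3) ℂ) : Matrix (Fin 3) (Fin 3) ℂ) := ⟨_, rfl⟩
  have hwordd : ∀ j : ↥S', ContDiff ℝ ∞ fun s : (Matrix (Fin 3) (Fin 3) ℂ × Matrix (Fin 3) (Fin 3) ℂ × Matrix (Fin 3) (Fin 3) ℂ) ×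
      ({w : InfinitePlace L // IsComplex w} → Fin 3 → ℝ) => word j s.1 s.2 := by
    intro j
    rw [hword]
    have hm := contDiff_coe_torusFamily_comp τ hτcoe ((hgm j).comp (contDiff_snd (E := Matrix (Fin 3) (Fin 3) ℂ × Matrix (Fin 3) (Fin 3) ℂ × Matrix (Fin 3) (Fin 3) ℂ)
      (F := {w : InfinitePlace L // IsComplex w} → Fin 3 → ℝ)))
    have hs := contDiff_coe_torusFamily_comp τ hτcoe ((hgs j).comp (contDiff_snd (E := Matrix (Fin 3) (Fin 3) ℂ × Matrix (Fin 3) (Fin 3) ℂ × Matrix (Fin 3) (Fin 3) ℂ)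
      (F := {w : InfinitePlace L // IsComplex w} → Fin 3 → ℝ)))
    exact (contDiff_const.mul (((contDiff_fst.comp contDiff_fst).mul (((hm.mul hs).mul (contDiff_fst.comp (contDiff_snd.comp contDiff_fst))).mul hs)).mul
      (contDiff_snd.comp (contDiff_snd.comp contDiff_fst)))).mul contDiff_const
  obtain ⟨Θ, hΘdef⟩ : ∃ Θ : (({w : {w : InfinitePlace L // IsComplex w} // w ∉ S' ∧ ¬ p w} → Matrix (Fin 3) (Fin 3) ℂ) ×
        (↥S' → Matrix (Fin 3) (Fin 3) ℂ × Matrix (Fin 3) (Fin 3) ℂ × Matrix (Fin 3) (Fin 3) ℂ)) ×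
        (({w : InfinitePlace L // IsComplex w} → Fin 3 → ℝ) × ({w : {w : InfinitePlace L // IsComplex w} // p w} → Matrix (Fin 3) (Fin 3) ℂ)) → ℂ,
      Θ = fun s => φ (Λ (s.2.2, (s.1.1, fun j => word j (s.1.2 j) s.2.1))) := ⟨_, rfl⟩
  have hΘ : ContDiff ℝ ∞ Θ := by
    rw [hΘdef]
    refine hφ.comp (hΛ.comp ((contDiff_snd.comp contDiff_snd).prodMk ((contDiff_fst.comp contDiff_fst).prodMk ?_)))
    refine contDiff_pi.2 fun j => ?_
    have hD : ContDiff ℝ ∞ fun s : (({w : {w : InfinitePlace L // IsComplex w} // w ∉ S' ∧ ¬ p w} → Matrix (Fin 3) (Fin 3) ℂ) ×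
        (↥S' → Matrix (Fin 3) (Fin 3) ℂ × Matrix (Fin 3) (Fin 3) ℂ × Matrix (Fin 3) (Fin 3) ℂ)) ×
        (({w : InfinitePlace L // IsComplex w} → Fin 3 → ℝ) × ({w : {w : InfinitePlace L // IsComplex w} // p w} → Matrix (Fin 3) (Fin 3) ℂ)) => (s.1.2 j, s.2.1) :=
      ((contDiff_apply ℝ (Matrix (Fin 3) (Fin 3) ℂ × Matrix (Fin 3) (Fin 3) ℂ × Matrix (Fin 3) (Fin 3) ℂ) j).comp (contDiff_snd.comp contDiff_fst)).prodMk
        (contDiff_fst.comp contDiff_snd)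
    exact (hwordd j).comp hD
  have hFΘ : ∀ q g η, F q g η = Θ (((fun i => (((g i : ↥(archLocal L 3 (Matrix.diagonal α) i.1)) : GL (Fin 3) ℂ) : Matrix (Fin 3) (Fin 3) ℂ)), r η), q) := by
    intro q g η
    rw [hFdef, hΘdef]
    simp only
    rw [hΛapply]
    congr 1
    refine Matrix.ext fun a b => Prod.ext rfl (funext fun w => ?_)
    simp only [Matrix.of_apply]
    by_cases hw : p w
    · rw [dif_pos hw, dif_pos hw]
    · rw [dif_neg hw, dif_neg hw]
      by_cases h : w ∈ S'
      · rw [dif_pos h, dif_pos h, hword]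
        simp only [r, Subgroup.coe_mul, Units.val_mul, Matrix.mul_assoc]
      · rw [dif_neg h, dif_neg h]
  -- block readers and the matrix-side compacts
  set Kφ : Set (Matrix (Fin 3) (Fin 3) (mixedSpace L)) := tsupport φ with hKφ
  have hKφc : IsCompact Kφ := hφc
  have hread : ∀ w : {w : InfinitePlace L // IsComplex w},
      Continuous fun M : Matrix (Fin 3) (Fin 3) (mixedSpace L) => (Matrix.of fun a b => (M a b).2 w : Matrix (Fin 3) (Fin 3) ℂ) := continuous_readBlock L
  have hreadg : ∀ (X : {w : {w : InfinitePlace L // IsComplex w} // p w} → Matrix (Fin 3) (Fin 3) ℂ) (mg : {w : {w : InfinitePlace L // IsComplex w} // w ∉ S' ∧ ¬ p w} → Matrix (Fin 3) (Fin 3) ℂ)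
      (mu : ↥S' → Matrix (Fin 3) (Fin 3) ℂ) (i : {w : {w : InfinitePlace L // IsComplex w} // w ∉ S' ∧ ¬ p w}),
      (Matrix.of fun a b => (Λ (X, (mg, mu)) a b).2 i.1 : Matrix (Fin 3) (Fin 3) ℂ) = mg i := by
    intro X mg mu i
    rw [hΛapply]
    ext a b
    simp only [Matrix.of_apply]
    rw [dif_neg i.2.2, dif_neg i.2.1]
  have hreadu : ∀ (X : {w : {w : InfinitePlace L // IsComplex w} // p w} → Matrix (Fin 3) (Fin 3) ℂ) (mg : {w : {w : InfinitePlace L // IsComplex w} // w ∉ S' ∧ ¬ p w} → Matrix (Fin 3) (Fin 3) ℂ)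
      (mu : ↥S' → Matrix (Fin 3) (Fin 3) ℂ) (j : ↥S'),
      (Matrix.of fun a b => (Λ (X, (mg, mu)) a b).2 j.1 : Matrix (Fin 3) (Fin 3) ℂ) = mu j := by
    intro X mg mu j
    rw [hΛapply]
    ext a b
    simp only [Matrix.of_apply]
    rw [dif_neg (fun hpj => hp _ hpj j.2), dif_pos j.2]
  -- the support clause of ★ (A4′), read matrix-side
  have hFsupp : ∀ K₀ ⊆ {c : {w : InfinitePlace L // IsComplex w} → Fin 3 → ℝ |
        ∀ (i : {w : {w : InfinitePlace L // IsComplex w} // w ∉ S' ∧ ¬ p w}) (a b : Fin 3), a ≠ b →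
          slotSign L α i.1 a ≠ slotSign L α i.1 b → Circle.exp (c i.1 a) ≠ Circle.exp (c i.1 b)} ×ˢ (univ : Set ({w : {w : InfinitePlace L // IsComplex w} // p w} → Matrix (Fin 3) (Fin 3) ℂ)),
      IsCompact K₀ → ∃ A : Set (∀ i : {w : {w : InfinitePlace L // IsComplex w} // w ∉ S' ∧ ¬ p w}, ↥(archLocal L 3 (Matrix.diagonal α) i.1)),
        ∃ Y₀ : Set (↥S' → ↥K × ↥(unipotentU (starRingEnd ℂ) J)), IsCompact A ∧ IsCompact Y₀ ∧ ∀ q ∈ K₀, ∀ g η, F q g η ≠ 0 → g ∈ A ∧ η ∈ Y₀ := by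
    intro K₀ _ hK₀
    -- the compact-place slots
    have hA : IsCompact (Set.pi Set.univ fun i : {w : {w : InfinitePlace L // IsComplex w} // w ∉ S' ∧ ¬ p w} =>
        {h : ↥(archLocal L 3 (Matrix.diagonal α) i.1) | ((h : GL (Fin 3) ℂ) : Matrix (Fin 3) (Fin 3) ℂ) ∈
          (fun M : Matrix (Fin 3) (Fin 3) (mixedSpace L) => (Matrix.of fun a b => (M a b).2 i.1 : Matrix (Fin 3) (Fin 3) ℂ)) '' Kφ}) :=
      isCompact_univ_pi fun i => isCompact_setOf_coe_archLocal_mem L 3 α i.1 hα (hKφc.image (hread i.1))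
    -- the split slots: `u_j` in a compact of `U(J)`, then `n_j` in a compact of `N`
    have hB : ∀ j : ↥S', IsCompact {u : ↥(unitaryGroupOfForm (starRingEnd ℂ) J) | ((u : GL (Fin 3) ℂ) : Matrix (Fin 3) (Fin 3) ℂ) ∈
        (fun M => ((T j : GL (Fin 3) ℂ) : Matrix (Fin 3) (Fin 3) ℂ) * M * (((T j)⁻¹ : GL (Fin 3) ℂ) : Matrix (Fin 3) (Fin 3) ℂ)) ''
          ((fun M : Matrix (Fin 3) (Fin 3) (mixedSpace L) => (Matrix.of fun a b => (M a b).2 j.1 : Matrix (Fin 3) (Fin 3) ℂ)) '' Kφ)} := fun j =>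
      (isClosedEmbedding_coe_unitaryGroupOfForm J hJdet).isCompact_preimage
        (((hKφc.image (hread j.1)).image ((continuous_const.mul continuous_id).mul continuous_const)))
    have hKc : IsCompact (Prod.fst '' K₀) := hK₀.image continuous_fst
    have hΞ : ∀ j : ↥S', ∃ N₀ : Set ↥(unipotentU (starRingEnd ℂ) J), IsCompact N₀ ∧
        ∀ c ∈ Prod.fst '' K₀, ∀ (k : ↥K) (n : ↥(unipotentU (starRingEnd ℂ) J)),
          ((k : ↥(unitaryGroupOfForm (starRingEnd ℂ) J)) *
            (τ ![0, c j.1 1, c j.1 2] * τ ![c j.1 0 / 2, 0, 0] * (n : ↥(unitaryGroupOfForm (starRingEnd ℂ) J)) * τ ![c j.1 0 / 2, 0, 0]) *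
            (k : ↥(unitaryGroupOfForm (starRingEnd ℂ) J))⁻¹) ∈
            {u : ↥(unitaryGroupOfForm (starRingEnd ℂ) J) | ((u : GL (Fin 3) ℂ) : Matrix (Fin 3) (Fin 3) ℂ) ∈
              (fun M => ((T j : GL (Fin 3) ℂ) : Matrix (Fin 3) (Fin 3) ℂ) * M * (((T j)⁻¹ : GL (Fin 3) ℂ) : Matrix (Fin 3) (Fin 3) ℂ)) ''
                ((fun M : Matrix (Fin 3) (Fin 3) (mixedSpace L) => (Matrix.of fun a b => (M a b).2 j.1 : Matrix (Fin 3) (Fin 3) ℂ)) '' Kφ)} → n ∈ N₀ := by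
      intro j
      obtain ⟨Ξ, hΞdef⟩ : ∃ Ξ : (({w : InfinitePlace L // IsComplex w} → Fin 3 → ℝ) × ↥(unitaryGroupOfForm (starRingEnd ℂ) J)) ×
          ↥(unitaryGroupOfForm (starRingEnd ℂ) J) → ↥(unitaryGroupOfForm (starRingEnd ℂ) J),
          Ξ = fun s => (τ ![0, s.1.1 j.1 1, s.1.1 j.1 2] * τ ![s.1.1 j.1 0 / 2, 0, 0])⁻¹ * ((s.1.2)⁻¹ * s.2 * s.1.2) *
            (τ ![s.1.1 j.1 0 / 2, 0, 0])⁻¹ := ⟨_, rfl⟩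
      have hΞc : Continuous Ξ := by
        rw [hΞdef]
        have h1 : Continuous fun s : (({w : InfinitePlace L // IsComplex w} → Fin 3 → ℝ) × ↥(unitaryGroupOfForm (starRingEnd ℂ) J)) ×
            ↥(unitaryGroupOfForm (starRingEnd ℂ) J) => τ ![0, s.1.1 j.1 1, s.1.1 j.1 2] :=
          (hct _ (hgm j)).comp (continuous_fst.comp continuous_fst)
        have h2 : Continuous fun s : (({w : InfinitePlace L // IsComplex w} → Fin 3 → ℝ) × ↥(unitaryGroupOfForm (starRingEnd ℂ) J)) ×
            ↥(unitaryGroupOfForm (starRingEnd ℂ) J) => τ ![s.1.1 j.1 0 / 2, 0, 0] :=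
          (hct _ (hgs j)).comp (continuous_fst.comp continuous_fst)
        have hk : Continuous fun s : (({w : InfinitePlace L // IsComplex w} → Fin 3 → ℝ) × ↥(unitaryGroupOfForm (starRingEnd ℂ) J)) ×
            ↥(unitaryGroupOfForm (starRingEnd ℂ) J) => s.1.2 := continuous_snd.comp continuous_fst
        exact ((h1.mul h2).inv.mul ((hk.inv.mul continuous_snd).mul hk)).mul h2.inv
      refine ⟨Subtype.val ⁻¹' (Ξ '' (((Prod.fst '' K₀) ×ˢ (K : Set ↥(unitaryGroupOfForm (starRingEnd ℂ) J))) ×ˢ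
          {u : ↥(unitaryGroupOfForm (starRingEnd ℂ) J) | ((u : GL (Fin 3) ℂ) : Matrix (Fin 3) (Fin 3) ℂ) ∈
            (fun M => ((T j : GL (Fin 3) ℂ) : Matrix (Fin 3) (Fin 3) ℂ) * M * (((T j)⁻¹ : GL (Fin 3) ℂ) : Matrix (Fin 3) (Fin 3) ℂ)) ''
              ((fun M : Matrix (Fin 3) (Fin 3) (mixedSpace L) => (Matrix.of fun a b => (M a b).2 j.1 : Matrix (Fin 3) (Fin 3) ℂ)) '' Kφ)})),
        hN.isClosedEmbedding_subtypeVal.isCompact_preimage (((hKc.prod hK).prod (hB j)).image hΞc), ?_⟩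
      intro c hc k n hu
      refine ⟨((c, (k : ↥(unitaryGroupOfForm (starRingEnd ℂ) J))), _), Set.mk_mem_prod (Set.mk_mem_prod hc k.2) hu, ?_⟩
      rw [hΞdef]
      simp only
      group
    choose N₀ hN₀c hN₀ using hΞ
    refine ⟨_, Set.pi Set.univ fun j => (Set.univ : Set ↥K) ×ˢ N₀ j, hA, isCompact_univ_pi fun j => isCompact_univ.prod (hN₀c j), ?_⟩
    intro q hq g η hne
    -- `φ ≠ 0` ⇒ the recombined matrix lies in `tsupport φ`
    have hmem : Λ (q.2, ((fun i => (((g i : ↥(archLocal L 3 (Matrix.diagonal α) i.1)) : GL (Fin 3) ℂ) : Matrix (Fin 3) (Fin 3) ℂ)),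
        fun j => word j (r η j) q.1)) ∈ Kφ := by
      rw [hFΘ, hΘdef] at hne
      exact subset_tsupport _ (Function.mem_support.2 hne)
    refine ⟨Set.mem_univ_pi.2 fun i => ⟨_, hmem, hreadg _ _ _ i⟩, Set.mem_univ_pi.2 fun j => Set.mk_mem_prod (Set.mem_univ _) ?_⟩
    refine hN₀ j q.1 ⟨q, hq, rfl⟩ (η j).1 (η j).2 ⟨word j (r η j) q.1, ⟨_, hmem, hreadu _ _ _ j⟩, ?_⟩
    have hcancel : ∀ (u : GL (Fin 3) ℂ) (M : Matrix (Fin 3) (Fin 3) ℂ),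
        (u : Matrix (Fin 3) (Fin 3) ℂ) * (((u⁻¹ : GL (Fin 3) ℂ) : Matrix (Fin 3) (Fin 3) ℂ) * M * (u : Matrix (Fin 3) (Fin 3) ℂ)) *
          ((u⁻¹ : GL (Fin 3) ℂ) : Matrix (Fin 3) (Fin 3) ℂ) = M := by
      intro u M
      rw [← Matrix.mul_assoc, ← Matrix.mul_assoc, Units.mul_inv, Matrix.one_mul, Matrix.mul_assoc, Units.mul_inv, Matrix.mul_one]
    show ((T j : GL (Fin 3) ℂ) : Matrix (Fin 3) (Fin 3) ℂ) * word j (r η j) q.1 * (((T j)⁻¹ : GL (Fin 3) ℂ) : Matrix (Fin 3) (Fin 3) ℂ) = _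
    rw [hword]
    simp only [r]
    rw [hcancel]
    simp only [Subgroup.coe_mul, Units.val_mul, Matrix.mul_assoc]
  -- ONE call of ★ (A4′) (prefactor `1`), then unfold `F`
  have key := contDiffOn_smoothModel_prod_param L α S' hα hreal hS'
    (fun i : {w : {w : InfinitePlace L // IsComplex w} // w ∉ S' ∧ ¬ p w} => i.1) (fun i => i.2.1) μ ν isOpen_univ r hr F Θ hΘ hFΘ hFsupp
    (fun _ => (1 : ℂ)) contDiffOn_const
  refine key.congr fun q _ => ?_
  rw [one_mul, hFdef]

omit [NumberField L] [IsCMField L] in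
/-- **UNIFORM COMPACT SUPPORTS OF THE ISOLATED SLOTS** (the block-support binders of the mixed junction): there is, for EVERY isolated place `w` (`p w`), ONE compact
`C_w ⊆ U(α)_w` such that the integrand of the partial unfolded model VANISHES whenever the slot at `w` is the matrix of a group element `k_w ∉ C_w` — whatever the other slots,
the spectators and the split words (the `w`-block of the recombined matrix is `↑↑k_w`, off the compact `w`-block of `tsupport φ̃`; ★ `isCompact_setOf_coe_archLocal_mem`).
[cite: Rogawski1990, §8.2 p. 122] [cite: DeitmarEchterhoff2014, Lemma 9.3.3] -/
theorem exists_isCompact_partialUnfoldedModel_pred_integrand_eq_zero (hα : ∀ i, α i ≠ 0)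
    (T : ↥S' → GL (Fin 3) ℂ) (φ : Matrix (Fin 3) (Fin 3) (mixedSpace L) → ℂ) (hφc : HasCompactSupport φ) :
    ∃ C : ∀ w : {w : {w : InfinitePlace L // IsComplex w} // p w}, Set ↥(archLocal L 3 (Matrix.diagonal α) w.1), (∀ w, IsCompact (C w)) ∧
      ∀ (k : ∀ w : {w : {w : InfinitePlace L // IsComplex w} // p w}, ↥(archLocal L 3 (Matrix.diagonal α) w.1))
        (w : {w : {w : InfinitePlace L // IsComplex w} // p w}), k w ∉ C w →
        ∀ (mu : ↥S' → Matrix (Fin 3) (Fin 3) ℂ) (g : ∀ i : {w : {w : InfinitePlace L // IsComplex w} // w ∉ S' ∧ ¬ p w}, ↥(archLocal L 3 (Matrix.diagonal α) i.1)),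
          φ (Matrix.of fun a b => ((0 : {w : InfinitePlace L // IsReal w} → ℝ),
            fun w' : {w : InfinitePlace L // IsComplex w} =>
              if hw : p w' then (((k ⟨w', hw⟩ : ↥(archLocal L 3 (Matrix.diagonal α) w')) : GL (Fin 3) ℂ) : Matrix (Fin 3) (Fin 3) ℂ) a b
              else if h : w' ∈ S' then ((((T ⟨w', h⟩)⁻¹ : GL (Fin 3) ℂ) : Matrix (Fin 3) (Fin 3) ℂ) * mu ⟨w', h⟩ * ((T ⟨w', h⟩ : GL (Fin 3) ℂ) : Matrix (Fin 3) (Fin 3) ℂ)) a b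
              else ((((g ⟨w', ⟨h, hw⟩⟩ : ↥(archLocal L 3 (Matrix.diagonal α) w')) : GL (Fin 3) ℂ) : Matrix (Fin 3) (Fin 3) ℂ)) a b)) = 0 := by
  have hread := fun w : {w : InfinitePlace L // IsComplex w} => continuous_readBlock L w
  refine ⟨fun w => {k : ↥(archLocal L 3 (Matrix.diagonal α) w.1) | ((k : GL (Fin 3) ℂ) : Matrix (Fin 3) (Fin 3) ℂ) ∈
      (fun M : Matrix (Fin 3) (Fin 3) (mixedSpace L) => (Matrix.of fun a b => (M a b).2 w.1 : Matrix (Fin 3) (Fin 3) ℂ)) '' tsupport φ},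
    fun w => isCompact_setOf_coe_archLocal_mem L 3 α w.1 hα (hφc.image (hread w.1)), fun k w hk mu g => ?_⟩
  refine image_eq_zero_of_notMem_tsupport fun hmem => hk ⟨_, hmem, ?_⟩
  ext a b
  simp only [Matrix.of_apply, dif_pos w.2]

end PartialModel

end Literature.NumberTheory.Automorphic.UnitaryGroup

end
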